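import Summits.QuantumFields.BalabanUV.Beta.EriceFlowEnclosureB12AsPrintedPointwiseFadingZeroHistory
import Summits.QuantumFields.BalabanUV.Beta.EriceFlowEnclosureB12AsPrintedPointwiseFadingRunRowsNecessity

/-!
# Beta / EriceFlowEnclosureB12AsPrintedPointwiseFadingZeroHistoryBoundary — part 13b: THE `b⋆ = 0` BOUNDARY IS DECIDED BY THE HISTORY TERM ALONE.
# Part 12 priced the deciding crux's row (iv) (the run-wise partial-sum floor of the β's along the solutions of (0.20) in a window ]0, γ₀]) in the β-flow team's one
# number: `b⋆ > 0` sufficient, `b⋆ ≥ 0` necessary, `b⋆ = 0` UNDECIDED by the letters (gen 50 OPEN (b)).  Part 13 (`…ZeroHistory`) split every β-value into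
# `b⋆ + (b⁰_k − b⋆) + (β_{k+1}(v) − b⁰_k)` with a SUMMABLE scale term; here the boundary is decided:
# §1 at `b⋆ = 0`, ROW (iv) FOR β ⟺ THE RUN-WISE FLOOR OF THE HISTORY TERM `β_{k+1}(v) − b⁰_k` (constants shift by `c∕(1−θ)²`); §2 SUFFICIENT — SCALE-SUMMABLE NEGATIVITY IS HARMLESS:
# a negative envelope `−e_k` of the history term from scale `k₀` on with `Σ e_k ≤ E` gives the END-grade carrier `BetaPartialSumsLowerH`, hence row (iv) and the rows triple at that level
# (e ≡ 0 = «β_{k+1} is minimised at the zero history», a ONE-SIDED (AF-1)); off the boundary the halved sandwich DOUBLES part 12's admissible level; §3 KILLING — COUPLING-CARRIED NEGATIVITY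
# IS FATAL: (K1) an eventual negative envelope `β_{k+1} ≤ −e_k` with unbounded partial sums (the deep survivor of part 12d with a profile), (K2) eventual non-positivity + negativity BOUNDED
# AWAY FROM ZERO ON THE CUBES `[η, δ]^{k+1}` (a floor would confine the deep survivor's couplings above some η > 0, where it climbs linearly) ⟹ NO run-wise floor at that level.  Under NE4
# the scale term is summable, so only negativity carried by the COUPLINGS can kill row (iv); part 13c (`…ZeroHistoryBoundaryWitness`) shows both outcomes occur with ALL letters and `b⋆ = 0`.
# (β-flow team, prover 2 = lower ∕ positivity side, unit `b2b-balaban-beta-bflow-p2`, gen 51; boundary part of part 13)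

HONEST FRAMING (page 1 of everything the β sub-cell writes): discharging `BetaPertH` makes Bałaban's UV stability UNCONDITIONAL — a
real constructive-QFT result; it is NOT the continuum limit and NOT the Clay problem.  HONEST DEPENDENCY (cell reorg 2026-08-19,
verbatim): «continuum YM on T⁴ ⇐ BetaPertH ∧ nine spine estimates (0/9 proved); BetaPertH ⇐ (D1) ∧ (D4) ∧ CAP+tail; G-an2-4 gates
asym, D1 and NE2/3/4.»  THIS MODULE DISCHARGES NOTHING: [folklore] finite-sum ∕ shooting calculus for an ABSTRACT `β : FlowStep.HBeta` under node U2's HYPOTHESIS SHAPES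
`T4CouplingMatching.HistLipschitz ∕ FadingMemory ∕ ScaleShiftRate` (NOT printed — [Balaban1987RG1] p. 298 ∕ p. 264; GAPS G-t4-U2-1∕2), part 11's `b⋆` and part 13's `b⁰` (reals ∕ a sequence
with DISPLAYED properties `hb` ∕ `hb0`, no definitions) and DISPLAYED one-sided envelopes; the tree's shooting table `FlowStep.{Y, gClamp, clampPrefix, Y_zero, Y_succ', clampPrefix_mem_box}`,
pub-balaban-gaps' `Gaps.EndRunwiseShooting.{rgEqH_shoot_of_survives, inInterval_shoot, windowSum_shoot}` ∕ `Gaps.EndRunwiseCone.runwisePS_of_betaPartialSumsLowerH`, part 12's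
`runRem_constHist_of_moduli` ∕ `survCont_of_moduli` ∕ `absBox_of_moduli_NE4` and part 13's `abs_windowSum_sub_le` ∕ `abs_zeroHist_sub_bstar_le` consumed BY NAME.  The physical flow has
`b⋆ > 0` if [I] Theorem 2 holds as typed (part 11c); the boundary is census value — it says WHICH STRUCTURE of a β-family row (iv) reads.  Nothing is asserted about Bałaban's (1.22).

WHAT THIS FILE PROVES (0 sorry, 0 def):
§1 **`runPS_of_histPS`** (b⋆ ≥ 0: history-term floor −M ⟹ row (iv) with −(M + c∕(1−θ)²)), **`histPS_of_runPS`** (b⋆ ≤ 0: the converse) — at b⋆ = 0 an equivalence.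
§2 **`betaPartialSumsLowerH_of_summableNeg`** (generic: floor −B before k₀, envelope −e_k after, Σe ≤ E ⟹ `BetaPartialSumsLowerH (k₀B + E) δ β`), `runPS_of_summableNeg`,
   **`betaPartialSumsLowerH_of_histNegSummable`** (letters + b⋆ ≥ 0 + a summable negative envelope of the history term ⟹ the carrier), **`rowsTriple_of_histNegSummable`** (⟹ rows (i)(iv)(C)),
   `betaPartialSumsLowerH_of_moduli_NE4'` ∕ `runPS_of_moduli_NE4'` ∕ `rows_at_level_of_moduli_NE4'` (off the boundary: part 12's supplier (β) and the three rows on the DOUBLED level `Cδ ≤ b⋆(1−θ)`),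
   `runRem_zeroHist_of_moduli` (row (i) with ONE level-free remainder sequence b⁰, r = Cγ₀∕(1−θ)).
§3 **`survives_of_eventual_negProfile`**, **`no_runPS_of_eventual_negProfile`** (K1), **`no_runPS_of_negAwayFromZero`** (K2).
NOT CLAIMED: anything about Bałaban's β; which side of the boundary any concrete scheme is on; K1⁹; `BetaPertH`; continuum; Clay.
-/

namespace Summit.QuantumFields.BalabanUV.Beta.EriceFlowEnclosureB12AsPrintedPointwiseFadingZeroHistoryBoundary

open Finset Filter Topology
open Literature.MathematicalPhysics.QuantumFieldTheory.Balaban1983to89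
open Literature.MathematicalPhysics.QuantumFieldTheory.Balaban1983to89.FlowStep (HBeta prefixOf Box mem_box box_mono RGEqH Y gClamp clampPrefix Y_zero Y_succ'
  clampPrefix_mem_box)
open Literature.MathematicalPhysics.QuantumFieldTheory.Balaban1983to89.FlowStepRuns (BetaPartialSumsLowerH)
open Literature.MathematicalPhysics.QuantumFieldTheory.Balaban1983to89.T4CouplingMatching (HistLipschitz FadingMemory ScaleShiftRate prefixOf_mem_box)
open Literature.MathematicalPhysics.QuantumFieldTheory.Balaban1983to89.T4BetaStationary (betaInf constant_nonneg_of_scaleShiftRate)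
open Summit.QuantumFields.BalabanUV.Gaps.EndRunwiseShooting (rgEqH_shoot_of_survives inInterval_shoot windowSum_shoot)
open Summit.QuantumFields.BalabanUV.Gaps.EndRunwiseCone (runwisePS_of_betaPartialSumsLowerH)
open Summit.QuantumFields.BalabanUV.Beta.EriceFlowEnclosureB12AsPrintedPointwiseFadingRunRows (runRem_constHist_of_moduli survCont_of_moduli absBox_of_moduli_NE4)
open Summit.QuantumFields.BalabanUV.Beta.EriceFlowEnclosureB12AsPrintedPointwiseFadingZeroHistory (abs_windowSum_sub_le abs_zeroHist_sub_bstar_le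
  exists_zeroHist abs_sub_zeroHist_le_box)

noncomputable section

variable {β : HBeta} {γ C c θ : ℝ} {Λ : ℕ → ℕ → ℝ}

/-! ## §1 At the boundary, row (iv) and the run-wise floor of the history term are equivalent -/

/-- **ROW (iv) FROM ITS HISTORY-TERM TWIN (`b⋆ ≥ 0`).**  Under NE4 + part 13's zero-history values (`hb0`) + part 11's `b⋆` (`hb`) with `0 ≤ b⋆`: if along every in-window solution of
(0.20) of level `γ₀` the window sums of the HISTORY TERM `β_{j+1}(gs_{≤j}) − b⁰_j` are `≥ −M`, then the window sums of the β's are `≥ −(M + c∕(1−θ)²)` — K1⁹'s row (iv) shape at that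
level (part 13's `abs_windowSum_sub_le`: the scale term costs `≤ cθ^k∕(1−θ)²`, the drift `b⋆(n−k)` is `≥ 0`). [cite: Balaban1987RG1, Thm 2 p.259 with (0.20) p.256] -/
theorem runPS_of_histPS (hS : ScaleShiftRate c θ γ β) (hθ0 : 0 ≤ θ) (hθ1 : θ < 1) (hC : 0 ≤ C) (hγ : 0 < γ) {b0 : ℕ → ℝ}
    (hb0 : ∀ (k : ℕ) (u : ℝ), 0 < u → u ≤ γ → |β k (fun _ : Fin (k + 1) => u) - b0 k| ≤ C * u / (1 - θ)) {bstar : ℝ}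
    (hb : ∀ u : ℝ, 0 < u → u ≤ γ → |betaInf β (fun _ : ℕ => u) - bstar| ≤ C * u / (1 - θ)) (hbstar : 0 ≤ bstar)
    {γ₀ M : ℝ}
    (hh : ∀ (n : ℕ) (gs : ℕ → ℝ), RGEqH n β gs → Step.InInterval γ₀ n gs →
      ∀ k, k ≤ n → -M ≤ ∑ j ∈ Ico k n, (β j (prefixOf gs j) - b0 j)) :
    ∀ (n : ℕ) (gs : ℕ → ℝ), RGEqH n β gs → Step.InInterval γ₀ n gs →
      ∀ k, k ≤ n → -(M + c / (1 - θ) ^ 2) ≤ ∑ j ∈ Ico k n, β j (prefixOf gs j) := by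
  intro n gs hrg hI k hk
  have h1θ : 0 < 1 - θ := by linarith
  have hc : 0 ≤ c := constant_nonneg_of_scaleShiftRate hS hγ
  have h := abs_le.mp (abs_windowSum_sub_le hS hθ0 hθ1 hC hγ hb0 hb gs hk)
  have hM := hh n gs hrg hI k hk
  have hdrift : 0 ≤ bstar * ((n : ℝ) - k) := mul_nonneg hbstar (by rw [sub_nonneg]; exact_mod_cast hk)
  have hθk : c * θ ^ k / (1 - θ) ^ 2 ≤ c / (1 - θ) ^ 2 :=
    div_le_div_of_nonneg_right (by nlinarith [pow_le_one₀ (n := k) hθ0 hθ1.le]) (by positivity)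
  linarith [h.1]

/-- **… AND CONVERSELY (`b⋆ ≤ 0`): ROW (iv) FORCES THE HISTORY-TERM FLOOR.**  If the window sums of the β's are `≥ −M` along every in-window solution of level `γ₀` and `b⋆ ≤ 0`, then the
window sums of the history term are `≥ −(M + c∕(1−θ)²)` along the same solutions.  With part 12d (`b⋆ ≥ 0` necessary) the live case is `b⋆ = 0`: THERE ROW (iv) FOR β AND THE RUN-WISE
FLOOR OF `β_{j+1}(·) − b⁰_j` ARE EQUIVALENT — the boundary is decided by the coupling dependence alone. [cite: Balaban1987RG1, Thm 2 p.259 with (0.20) p.256] -/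
theorem histPS_of_runPS (hS : ScaleShiftRate c θ γ β) (hθ0 : 0 ≤ θ) (hθ1 : θ < 1) (hC : 0 ≤ C) (hγ : 0 < γ) {b0 : ℕ → ℝ}
    (hb0 : ∀ (k : ℕ) (u : ℝ), 0 < u → u ≤ γ → |β k (fun _ : Fin (k + 1) => u) - b0 k| ≤ C * u / (1 - θ)) {bstar : ℝ}
    (hb : ∀ u : ℝ, 0 < u → u ≤ γ → |betaInf β (fun _ : ℕ => u) - bstar| ≤ C * u / (1 - θ)) (hbstar : bstar ≤ 0)
    {γ₀ M : ℝ}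
    (hps : ∀ (n : ℕ) (gs : ℕ → ℝ), RGEqH n β gs → Step.InInterval γ₀ n gs →
      ∀ k, k ≤ n → -M ≤ ∑ j ∈ Ico k n, β j (prefixOf gs j)) :
    ∀ (n : ℕ) (gs : ℕ → ℝ), RGEqH n β gs → Step.InInterval γ₀ n gs →
      ∀ k, k ≤ n → -(M + c / (1 - θ) ^ 2) ≤ ∑ j ∈ Ico k n, (β j (prefixOf gs j) - b0 j) := by
  intro n gs hrg hI k hk
  have h1θ : 0 < 1 - θ := by linarith
  have hc : 0 ≤ c := constant_nonneg_of_scaleShiftRate hS hγ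
  have h := abs_le.mp (abs_windowSum_sub_le hS hθ0 hθ1 hC hγ hb0 hb gs hk)
  have hM := hps n gs hrg hI k hk
  have hdrift : bstar * ((n : ℝ) - k) ≤ 0 := mul_nonpos_of_nonpos_of_nonneg hbstar (by rw [sub_nonneg]; exact_mod_cast hk)
  have hθk : c * θ ^ k / (1 - θ) ^ 2 ≤ c / (1 - θ) ^ 2 :=
    div_le_div_of_nonneg_right (by nlinarith [pow_le_one₀ (n := k) hθ0 hθ1.le]) (by positivity)
  linarith [h.2]

/-! ## §2 Sufficient at the boundary: scale-summable negativity is harmless -/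

/-- **A SUMMABLE NEGATIVE ENVELOPE GIVES THE END-GRADE CARRIER** (generic, no letters): a floor `−B` on the boxes of the first `k₀` scales (`0 ≤ B`) and an envelope `β_{j+1} ≥ −e_j` on the
boxes from scale `k₀` on with `e_j ≥ 0`, `Σ_{j∈[k₀,n)} e_j ≤ E` for every n ⟹ `BetaPartialSumsLowerH (k₀B + E) δ β` (a window meets at most `k₀` floor-less scales costing `B` each, and the
envelope costs at most `E`).  Part 12's `betaPartialSumsLowerH_of_eventualLowerH` is `e ≡ 0`. [cite: Balaban1987RG1, Thm 2 p.259 and §1 p.264] -/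
theorem betaPartialSumsLowerH_of_summableNeg {δ B E : ℝ} {e : ℕ → ℝ} {k₀ : ℕ} (hB : 0 ≤ B)
    (hfirst : ∀ (j : ℕ) (v : Fin (j + 1) → ℝ), j < k₀ → v ∈ Box δ j → -B ≤ β j v)
    (htail : ∀ (j : ℕ) (v : Fin (j + 1) → ℝ), k₀ ≤ j → v ∈ Box δ j → -e j ≤ β j v)
    (he : ∀ j, 0 ≤ e j) (hE : ∀ n, ∑ j ∈ Ico k₀ n, e j ≤ E) :
    BetaPartialSumsLowerH (k₀ * B + E) δ β := by
  intro g hg k n _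
  have hv : ∀ j, prefixOf g j ∈ Box δ j := fun j => mem_box.mpr fun i => hg i
  have hterm : ∀ j ∈ Ico k n, -(if j < k₀ then B else e j) ≤ β j (prefixOf g j) := by
    intro j _
    split_ifs with hj
    · exact hfirst j _ hj (hv j)
    · exact htail j _ (not_lt.mp hj) (hv j)
  have h1 : ∑ j ∈ Ico k n, -(if j < k₀ then B else e j) ≤ ∑ j ∈ Ico k n, β j (prefixOf g j) := sum_le_sum hterm
  have h2 : ∑ j ∈ Ico k n, (if j < k₀ then B else e j) ≤ k₀ * B + E := by
    rw [sum_ite]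
    have hsub : (Ico k n).filter (fun j => j < k₀) ⊆ range k₀ := fun j hj => mem_range.mpr (mem_filter.mp hj).2
    have hcard : (((Ico k n).filter (fun j => j < k₀)).card : ℝ) ≤ k₀ := by exact_mod_cast (card_le_card hsub).trans (card_range k₀).le
    have hA : ∑ j ∈ (Ico k n).filter (fun j => j < k₀), B ≤ k₀ * B := by rw [sum_const, nsmul_eq_mul]; exact mul_le_mul_of_nonneg_right hcard hB
    have hsub2 : (Ico k n).filter (fun j => ¬ j < k₀) ⊆ Ico k₀ n := fun j hj =>
      mem_Ico.mpr ⟨not_lt.mp (mem_filter.mp hj).2, (mem_Ico.mp (mem_filter.mp hj).1).2⟩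
    have hB' : ∑ j ∈ (Ico k n).filter (fun j => ¬ j < k₀), e j ≤ ∑ j ∈ Ico k₀ n, e j := sum_le_sum_of_subset_of_nonneg hsub2 fun j _ _ => he j
    linarith [hE n]
  have h3 : ∑ j ∈ Ico k n, -(if j < k₀ then B else e j) = -∑ j ∈ Ico k n, (if j < k₀ then B else e j) := sum_neg_distrib _
  linarith

/-- **AS ROW (iv)**: under the hypotheses of `betaPartialSumsLowerH_of_summableNeg` (`δ > 0`), along every in-window solution of (0.20) of level δ every window sum of the β's is
`≥ −(k₀B + E)` (pub-balaban-gaps' `runwisePS_of_betaPartialSumsLowerH` BY NAME). [cite: Balaban1987RG1, Thm 2 p.259 with (0.20) p.256] -/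
theorem runPS_of_summableNeg {δ B E : ℝ} {e : ℕ → ℝ} {k₀ : ℕ} (hδ : 0 < δ) (hB : 0 ≤ B)
    (hfirst : ∀ (j : ℕ) (v : Fin (j + 1) → ℝ), j < k₀ → v ∈ Box δ j → -B ≤ β j v)
    (htail : ∀ (j : ℕ) (v : Fin (j + 1) → ℝ), k₀ ≤ j → v ∈ Box δ j → -e j ≤ β j v)
    (he : ∀ j, 0 ≤ e j) (hE : ∀ n, ∑ j ∈ Ico k₀ n, e j ≤ E) :
    ∀ (n : ℕ) (gs : ℕ → ℝ), RGEqH n β gs → Step.InInterval δ n gs →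
      ∀ k, k ≤ n → -(k₀ * B + E) ≤ ∑ j ∈ Ico k n, β j (prefixOf gs j) :=
  runwisePS_of_betaPartialSumsLowerH hδ (betaPartialSumsLowerH_of_summableNeg hB hfirst htail he hE)

/-- **AT THE BOUNDARY, A SUMMABLE NEGATIVE ENVELOPE OF THE HISTORY TERM GIVES THE CARRIER.**  Under the moduli + NE4 + `b⋆` (`hb`, `0 ≤ b⋆`) + the zero-history values (`hb0`), on a box
`0 < δ ≤ γ`: if the history term obeys `β_{k+1}(v) − b⁰_k ≥ −e_k` on ]0, δ]^{k+1} for `k ≥ k₀` with `e_k ≥ 0`, `Σ_{k∈[k₀,n)} e_k ≤ E`, then `BetaPartialSumsLowerH (k₀B + (c∕(1−θ)² + E)) δ β`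
with `B := |b⋆| + 2Cδ∕(1−θ) + c∕(1−θ)` (part 12's sign-free box for the first scales; afterwards `β_{k+1} ≥ b⋆ − cθ^k∕(1−θ) − e_k` and the scale term is summable).  `e ≡ 0` is the
ONE-SIDED (AF-1) «β_{k+1} is minimised at the zero history»: it alone carries row (iv) across the boundary `b⋆ = 0`. [cite: Balaban1987RG1, Thm 2 p.259, (2.14) p.268, §5 p.298] -/
theorem betaPartialSumsLowerH_of_histNegSummable (hL : HistLipschitz Λ γ β) (hΛ : FadingMemory C θ Λ) (hS : ScaleShiftRate c θ γ β)
    (hθ0 : 0 ≤ θ) (hθ1 : θ < 1) (hC : 0 ≤ C) (hγ : 0 < γ) {b0 : ℕ → ℝ}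
    (hb0 : ∀ (k : ℕ) (u : ℝ), 0 < u → u ≤ γ → |β k (fun _ : Fin (k + 1) => u) - b0 k| ≤ C * u / (1 - θ)) {bstar : ℝ}
    (hb : ∀ u : ℝ, 0 < u → u ≤ γ → |betaInf β (fun _ : ℕ => u) - bstar| ≤ C * u / (1 - θ)) (hbstar : 0 ≤ bstar)
    {δ : ℝ} (hδ : 0 < δ) (hδγ : δ ≤ γ) {e : ℕ → ℝ} {E : ℝ} {k₀ : ℕ}
    (hneg : ∀ (k : ℕ) (v : Fin (k + 1) → ℝ), k₀ ≤ k → v ∈ Box δ k → -e k ≤ β k v - b0 k)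
    (he : ∀ k, 0 ≤ e k) (hE : ∀ n, ∑ k ∈ Ico k₀ n, e k ≤ E) :
    BetaPartialSumsLowerH (k₀ * (|bstar| + 2 * C * δ / (1 - θ) + c / (1 - θ)) + (c / (1 - θ) ^ 2 + E)) δ β := by
  have h1θ : 0 < 1 - θ := by linarith
  have hc : 0 ≤ c := constant_nonneg_of_scaleShiftRate hS hγ
  have hbox := (absBox_of_moduli_NE4 hL hΛ hS hθ0 hθ1 hC hb hδ hδγ).1
  refine betaPartialSumsLowerH_of_summableNeg (e := fun k => c * θ ^ k / (1 - θ) + e k) (by positivity)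
    (fun j v _ hv => hbox j v hv) (fun j v hj hv => ?_) (fun j => by have := he j; positivity) (fun n => ?_)
  · have h1 := hneg j v hj hv
    have h2 := (abs_le.mp (abs_zeroHist_sub_bstar_le hS hθ1 hC hγ hb0 hb j)).1
    linarith
  · rw [sum_add_distrib]
    have hg : ∑ k ∈ Ico k₀ n, c * θ ^ k / (1 - θ) ≤ c / (1 - θ) ^ 2 := by
      calc ∑ k ∈ Ico k₀ n, c * θ ^ k / (1 - θ) = c / (1 - θ) * ∑ k ∈ Ico k₀ n, θ ^ k := by
            rw [mul_sum]; exact sum_congr rfl fun k _ => by ring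
        _ ≤ c / (1 - θ) * (θ ^ k₀ / (1 - θ)) :=
            mul_le_mul_of_nonneg_left (geom_sum_Ico_le_of_lt_one hθ0 hθ1) (div_nonneg hc h1θ.le)
        _ ≤ c / (1 - θ) * (1 / (1 - θ)) :=
            mul_le_mul_of_nonneg_left (div_le_div_of_nonneg_right (pow_le_one₀ hθ0 hθ1.le) h1θ.le) (div_nonneg hc h1θ.le)
        _ = c / (1 - θ) ^ 2 := by rw [div_mul_div_comm, mul_one, sq]
    linarith [hE n]

/-- **THE ROWS TRIPLE ACROSS THE BOUNDARY.**  Under the hypotheses of `betaPartialSumsLowerH_of_histNegSummable`: K1⁹'s rows ∃-shape `∃ b r γ₀ M, 0 < γ₀ ∧ (i) ∧ (iv) ∧ (C)` over β, with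
`γ₀ := δ`, `b k := β_{k+1}(δ,…,δ)`, `r := Cδ∕(1−θ)` (part 12's `runRem_constHist_of_moduli`), `M := k₀B + c∕(1−θ)² + E`, (C) from the modulus (`survCont_of_moduli`).  With `b⋆ = 0`
allowed: the rows hold at the boundary as soon as the history term has a summable negative envelope. [cite: Balaban1987RG1, Thm 2 p.259, Thm 3 p.264, §1 pp.263–264, (5.10) p.293] -/
theorem rowsTriple_of_histNegSummable (hL : HistLipschitz Λ γ β) (hΛ : FadingMemory C θ Λ) (hS : ScaleShiftRate c θ γ β)
    (hθ0 : 0 ≤ θ) (hθ1 : θ < 1) (hC : 0 ≤ C) (hγ : 0 < γ) {b0 : ℕ → ℝ}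
    (hb0 : ∀ (k : ℕ) (u : ℝ), 0 < u → u ≤ γ → |β k (fun _ : Fin (k + 1) => u) - b0 k| ≤ C * u / (1 - θ)) {bstar : ℝ}
    (hb : ∀ u : ℝ, 0 < u → u ≤ γ → |betaInf β (fun _ : ℕ => u) - bstar| ≤ C * u / (1 - θ)) (hbstar : 0 ≤ bstar)
    {δ : ℝ} (hδ : 0 < δ) (hδγ : δ ≤ γ) {e : ℕ → ℝ} {E : ℝ} {k₀ : ℕ}
    (hneg : ∀ (k : ℕ) (v : Fin (k + 1) → ℝ), k₀ ≤ k → v ∈ Box δ k → -e k ≤ β k v - b0 k)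
    (he : ∀ k, 0 ≤ e k) (hE : ∀ n, ∑ k ∈ Ico k₀ n, e k ≤ E) :
    ∃ (b : ℕ → ℝ) (r γ₀ M : ℝ), 0 < γ₀ ∧ γ₀ ≤ γ ∧
      (∀ (n : ℕ) (gs : ℕ → ℝ), RGEqH n β gs → Step.InInterval γ₀ n gs → ∀ k, k ≤ n → |β k (prefixOf gs k) - b k| ≤ r) ∧
      (∀ (n : ℕ) (gs : ℕ → ℝ), RGEqH n β gs → Step.InInterval γ₀ n gs →
        ∀ k, k ≤ n → -M ≤ ∑ j ∈ Ico k n, β j (prefixOf gs j)) ∧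
      ∀ k : ℕ, ContinuousOn (fun x : ℝ => β k (clampPrefix β γ₀ k x))
        {x : ℝ | 0 < x ∧ x ≤ γ₀ ∧ ∀ j, j ≤ k → 1 / γ₀ ^ 2 ≤ Y β γ₀ j x} :=
  ⟨fun k => β k (fun _ : Fin (k + 1) => δ), C * δ / (1 - θ), δ, _, hδ, hδγ,
    runRem_constHist_of_moduli hL hΛ hθ0 hθ1 hC hδ hδγ,
    runwisePS_of_betaPartialSumsLowerH hδ
      (betaPartialSumsLowerH_of_histNegSummable hL hΛ hS hθ0 hθ1 hC hγ hb0 hb hbstar hδ hδγ hneg he hE),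
    survCont_of_moduli hL hδ hδγ⟩

/-- **OFF THE BOUNDARY, THE NORMAL FORM DOUBLES PART 12's LEVEL.**  Under the moduli + NE4 + `b⋆` (`hb`): on every level `0 < δ ≤ γ` with **`Cδ ≤ b⋆(1−θ)`** (part 12's supplier (β) needs
`2Cδ ≤ b⋆(1−θ)`), `BetaPartialSumsLowerH (c∕(1−θ)²) δ β` — through the zero history every β-value is `≥ b⋆ − Cδ∕(1−θ) − cθ^k∕(1−θ) ≥ −cθ^k∕(1−θ)`, a summable envelope from scale 0.
[cite: Balaban1987RG1, Thm 2 p.259 and §5 p.298] -/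
theorem betaPartialSumsLowerH_of_moduli_NE4' (hL : HistLipschitz Λ γ β) (hΛ : FadingMemory C θ Λ) (hS : ScaleShiftRate c θ γ β)
    (hθ0 : 0 ≤ θ) (hθ1 : θ < 1) (hC : 0 ≤ C) (hγ : 0 < γ) {bstar : ℝ}
    (hb : ∀ u : ℝ, 0 < u → u ≤ γ → |betaInf β (fun _ : ℕ => u) - bstar| ≤ C * u / (1 - θ))
    {δ : ℝ} (hδ : 0 < δ) (hδγ : δ ≤ γ) (hsmall : C * δ ≤ bstar * (1 - θ)) :
    BetaPartialSumsLowerH (c / (1 - θ) ^ 2) δ β := by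
  have h1θ : 0 < 1 - θ := by linarith
  have hc : 0 ≤ c := constant_nonneg_of_scaleShiftRate hS hγ
  obtain ⟨b0, hb0⟩ := exists_zeroHist hL hΛ hθ0 hθ1 hC hγ
  have hlev : C * δ / (1 - θ) ≤ bstar := by rw [div_le_iff₀ h1θ]; exact hsmall
  have h := betaPartialSumsLowerH_of_summableNeg (β := β) (δ := δ) (k₀ := 0) (B := 0) (e := fun k => c * θ ^ k / (1 - θ))
    (E := c / (1 - θ) ^ 2) le_rfl (fun j _ hj _ => absurd hj (Nat.not_lt_zero j)) (fun j v _ hv => ?_) (fun j => by positivity) (fun n => ?_)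
  · simpa using h
  · have h1 := (abs_le.mp (abs_sub_zeroHist_le_box hL hΛ hθ0 hθ1 hC hγ hb0 hδ hδγ hv)).1
    have h2 := (abs_le.mp (abs_zeroHist_sub_bstar_le hS hθ1 hC hγ hb0 hb j)).1
    linarith
  · calc ∑ k ∈ Ico 0 n, c * θ ^ k / (1 - θ) = c / (1 - θ) * ∑ k ∈ Ico 0 n, θ ^ k := by
          rw [mul_sum]; exact sum_congr rfl fun k _ => by ring
      _ ≤ c / (1 - θ) * (θ ^ 0 / (1 - θ)) := mul_le_mul_of_nonneg_left (geom_sum_Ico_le_of_lt_one hθ0 hθ1) (div_nonneg hc h1θ.le)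
      _ = c / (1 - θ) ^ 2 := by rw [pow_zero, div_mul_div_comm, mul_one, sq]

/-- … and as ROW (iv) at that level (the run-wise floor `−c∕(1−θ)²` along every in-window solution of (0.20), `Cδ ≤ b⋆(1−θ)`). [cite: Balaban1987RG1, Thm 2 p.259 with (0.20) p.256] -/
theorem runPS_of_moduli_NE4' (hL : HistLipschitz Λ γ β) (hΛ : FadingMemory C θ Λ) (hS : ScaleShiftRate c θ γ β)
    (hθ0 : 0 ≤ θ) (hθ1 : θ < 1) (hC : 0 ≤ C) (hγ : 0 < γ) {bstar : ℝ}
    (hb : ∀ u : ℝ, 0 < u → u ≤ γ → |betaInf β (fun _ : ℕ => u) - bstar| ≤ C * u / (1 - θ))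
    {δ : ℝ} (hδ : 0 < δ) (hδγ : δ ≤ γ) (hsmall : C * δ ≤ bstar * (1 - θ)) :
    ∀ (n : ℕ) (gs : ℕ → ℝ), RGEqH n β gs → Step.InInterval δ n gs →
      ∀ k, k ≤ n → -(c / (1 - θ) ^ 2) ≤ ∑ j ∈ Ico k n, β j (prefixOf gs j) :=
  runwisePS_of_betaPartialSumsLowerH hδ (betaPartialSumsLowerH_of_moduli_NE4' hL hΛ hS hθ0 hθ1 hC hγ hb hδ hδγ hsmall)

/-- **ROW (i) WITH THE INTRINSIC, LEVEL-FREE REMAINDER SEQUENCE `b⁰`** (moduli alone, no NE4): along every in-window solution of (0.20) of level `0 < γ₀ ≤ γ`,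
`|β_{k+1}(gs_{≤k}) − b⁰_k| ≤ Cγ₀∕(1−θ)` — the deciding crux's row (i) shape with ONE sequence `b⁰` serving EVERY level (part 12's `runRem_constHist_of_moduli` used the level's own
constant-history values). [cite: Balaban1987RG1, Thm 3 p.264 with (1.22) p.264 and §5 p.298] -/
theorem runRem_zeroHist_of_moduli (hL : HistLipschitz Λ γ β) (hΛ : FadingMemory C θ Λ) (hθ0 : 0 ≤ θ) (hθ1 : θ < 1) (hC : 0 ≤ C) (hγ : 0 < γ)
    {b0 : ℕ → ℝ} (hb0 : ∀ (k : ℕ) (u : ℝ), 0 < u → u ≤ γ → |β k (fun _ : Fin (k + 1) => u) - b0 k| ≤ C * u / (1 - θ))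
    {γ₀ : ℝ} (hγ₀ : 0 < γ₀) (hγ₀γ : γ₀ ≤ γ) :
    ∀ (n : ℕ) (gs : ℕ → ℝ), RGEqH n β gs → Step.InInterval γ₀ n gs →
      ∀ k, k ≤ n → |β k (prefixOf gs k) - b0 k| ≤ C * γ₀ / (1 - θ) :=
  fun _ _ _ hI _ hk => abs_sub_zeroHist_le_box hL hΛ hθ0 hθ1 hC hγ hb0 hγ₀ hγ₀γ (prefixOf_mem_box hk hI)

/-- **THE THREE ROWS ON THE DOUBLED LEVEL**: under the moduli + NE4 + `b⁰` + `b⋆`, on every level `0 < δ ≤ γ` with `Cδ ≤ b⋆(1−θ)`: (i) with `b := b⁰`, `r := Cδ∕(1−θ)`; (iv) with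
`M := c∕(1−θ)²`; (C) from the modulus (part 12's `rows_at_level_of_moduli_NE4` needs `2Cδ ≤ b⋆(1−θ)` and has `r = 2Cδ∕(1−θ) + c∕(1−θ)`). [cite: Balaban1987RG1, Thm 2 p.259, Thm 3 p.264, §1 pp.263–264, (5.10) p.293] -/
theorem rows_at_level_of_moduli_NE4' (hL : HistLipschitz Λ γ β) (hΛ : FadingMemory C θ Λ) (hS : ScaleShiftRate c θ γ β)
    (hθ0 : 0 ≤ θ) (hθ1 : θ < 1) (hC : 0 ≤ C) (hγ : 0 < γ) {b0 : ℕ → ℝ}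
    (hb0 : ∀ (k : ℕ) (u : ℝ), 0 < u → u ≤ γ → |β k (fun _ : Fin (k + 1) => u) - b0 k| ≤ C * u / (1 - θ)) {bstar : ℝ}
    (hb : ∀ u : ℝ, 0 < u → u ≤ γ → |betaInf β (fun _ : ℕ => u) - bstar| ≤ C * u / (1 - θ))
    {δ : ℝ} (hδ : 0 < δ) (hδγ : δ ≤ γ) (hsmall : C * δ ≤ bstar * (1 - θ)) :
    (∀ (n : ℕ) (gs : ℕ → ℝ), RGEqH n β gs → Step.InInterval δ n gs → ∀ k, k ≤ n → |β k (prefixOf gs k) - b0 k| ≤ C * δ / (1 - θ)) ∧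
      (∀ (n : ℕ) (gs : ℕ → ℝ), RGEqH n β gs → Step.InInterval δ n gs →
        ∀ k, k ≤ n → -(c / (1 - θ) ^ 2) ≤ ∑ j ∈ Ico k n, β j (prefixOf gs j)) ∧
      ∀ k : ℕ, ContinuousOn (fun x : ℝ => β k (clampPrefix β δ k x))
        {x : ℝ | 0 < x ∧ x ≤ δ ∧ ∀ j, j ≤ k → 1 / δ ^ 2 ≤ Y β δ j x} :=
  ⟨runRem_zeroHist_of_moduli hL hΛ hθ0 hθ1 hC hγ hb0 hδ hδγ, runPS_of_moduli_NE4' hL hΛ hS hθ0 hθ1 hC hγ hb hδ hδγ hsmall,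
    survCont_of_moduli hL hδ hδγ⟩

/-! ## §3 Killing at the boundary: coupling-carried negativity is fatal -/

/-- **THE DEEP SURVIVOR WITH A PROFILE** (part 12d's `survives_of_eventual_neg` with `ε ↦ e_k`): at a level `δ > 0` suppose a ceiling `β_{k+1} ≤ B` (`0 ≤ B`) on all boxes and
`β_{k+1} ≤ −e_k` (`0 ≤ e_k`) on the boxes from scale `k₀` on.  The clamped forward run started at `g₀ = 1∕√(1∕δ² + k₀B)` loses at most `B` per scale up to `k₀`, gains at least `e_k` per scale
afterwards (`Y_{k₀} + Σ_{j∈[k₀,k₀+m)} e_j ≤ Y_{k₀+m}`), hence never meets the clamp — a genuine solution of (0.20) of every depth in ]0, δ]. [cite: Balaban1987RG1, (0.20) p.256] -/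
theorem survives_of_eventual_negProfile {δ B : ℝ} {e : ℕ → ℝ} {k₀ : ℕ} (hδ : 0 < δ) (hB : 0 ≤ B) (he : ∀ k, 0 ≤ e k)
    (hub : ∀ (k : ℕ) (v : Fin (k + 1) → ℝ), v ∈ Box δ k → β k v ≤ B)
    (hneg : ∀ (k : ℕ) (v : Fin (k + 1) → ℝ), k₀ ≤ k → v ∈ Box δ k → β k v ≤ -e k) :
    (∀ k, k ≤ k₀ → 1 / δ ^ 2 + ((k₀ : ℝ) - k) * B ≤ Y β δ k (1 / Real.sqrt (1 / δ ^ 2 + k₀ * B))) ∧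
      (∀ m : ℕ, Y β δ k₀ (1 / Real.sqrt (1 / δ ^ 2 + k₀ * B)) + ∑ j ∈ Ico k₀ (k₀ + m), e j ≤
        Y β δ (k₀ + m) (1 / Real.sqrt (1 / δ ^ 2 + k₀ * B))) ∧
      ∀ k, 1 / δ ^ 2 ≤ Y β δ k (1 / Real.sqrt (1 / δ ^ 2 + k₀ * B)) := by
  set g₀ : ℝ := 1 / Real.sqrt (1 / δ ^ 2 + k₀ * B) with hg₀
  have hpos : 0 < 1 / δ ^ 2 + k₀ * B := by positivity
  have hY0 : Y β δ 0 g₀ = 1 / δ ^ 2 + k₀ * B := by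
    rw [Y_zero, hg₀, div_pow, one_pow, Real.sq_sqrt hpos.le, one_div_one_div]
  have h1 : ∀ k, k ≤ k₀ → 1 / δ ^ 2 + ((k₀ : ℝ) - k) * B ≤ Y β δ k g₀ := by
    intro k
    induction k with
    | zero => intro _; rw [hY0]; simp
    | succ k ih =>
      intro hk
      have h := ih (Nat.le_of_succ_le hk)
      have hb := hub k _ (clampPrefix_mem_box (β := β) hδ k g₀)
      rw [Y_succ']
      push_cast
      nlinarith
  have hk₀ : 1 / δ ^ 2 ≤ Y β δ k₀ g₀ := by
    have := h1 k₀ le_rfl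
    simpa using this
  have h2 : ∀ m : ℕ, Y β δ k₀ g₀ + ∑ j ∈ Ico k₀ (k₀ + m), e j ≤ Y β δ (k₀ + m) g₀ := by
    intro m
    induction m with
    | zero => simp
    | succ m ih =>
      have hn := hneg (k₀ + m) _ (Nat.le_add_right _ _) (clampPrefix_mem_box (β := β) hδ (k₀ + m) g₀)
      rw [← add_assoc, Y_succ', sum_Ico_succ_top (Nat.le_add_right k₀ m)]
      linarith
  refine ⟨h1, h2, fun k => ?_⟩
  rcases le_or_gt k k₀ with hk | hk
  · have h := h1 k hk
    have hnn : 0 ≤ ((k₀ : ℝ) - k) * B := mul_nonneg (by rw [sub_nonneg]; exact_mod_cast hk) hB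
    linarith
  · obtain ⟨m, rfl⟩ : ∃ m, k = k₀ + m := ⟨k - k₀, by omega⟩
    have h := h2 m
    have hnn : 0 ≤ ∑ j ∈ Ico k₀ (k₀ + m), e j := sum_nonneg fun j _ => he j
    linarith

/-- **(K1) A NON-SUMMABLE NEGATIVE ENVELOPE KILLS ROW (iv).**  Under the hypotheses of `survives_of_eventual_negProfile`, if the partial sums `Σ_{j∈[k₀,k₀+m)} e_j` are unbounded then
for every `M` some in-window solution of (0.20) of level δ has a window sum `< −M` (the deep survivor read from `k₀`; `windowSum_shoot` BY NAME).  With part 13's normal form: at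
`b⋆ = 0` the scale term can never do this (it is summable); only the history term can. [cite: Balaban1987RG1, (0.20) p.256 and Thm 2 p.259] -/
theorem no_runPS_of_eventual_negProfile {δ B : ℝ} {e : ℕ → ℝ} {k₀ : ℕ} (hδ : 0 < δ) (hB : 0 ≤ B) (he : ∀ k, 0 ≤ e k)
    (hub : ∀ (k : ℕ) (v : Fin (k + 1) → ℝ), v ∈ Box δ k → β k v ≤ B)
    (hneg : ∀ (k : ℕ) (v : Fin (k + 1) → ℝ), k₀ ≤ k → v ∈ Box δ k → β k v ≤ -e k)
    (hdiv : ∀ M : ℝ, ∃ m : ℕ, M < ∑ j ∈ Ico k₀ (k₀ + m), e j) (M : ℝ) :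
    ∃ (n : ℕ) (gs : ℕ → ℝ), RGEqH n β gs ∧ Step.InInterval δ n gs ∧
      ∃ k, k ≤ n ∧ ∑ j ∈ Ico k n, β j (prefixOf gs j) < -M := by
  obtain ⟨-, h2, hsurv⟩ := survives_of_eventual_negProfile hδ hB he hub hneg
  set g₀ : ℝ := 1 / Real.sqrt (1 / δ ^ 2 + k₀ * B)
  obtain ⟨m, hm⟩ := hdiv M
  refine ⟨k₀ + m, fun i => gClamp δ (Y β δ i g₀), rgEqH_shoot_of_survives hδ fun k _ => hsurv k, inInterval_shoot hδ _ _,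
    k₀, Nat.le_add_right _ _, ?_⟩
  rw [windowSum_shoot k₀ (k₀ + m) (Nat.le_add_right _ _) g₀]
  have h := h2 m
  linarith

/-- **(K2) NEGATIVITY BOUNDED AWAY FROM ZERO ON THE CUBES `[η, δ]^{k+1}` KILLS ROW (iv).**  At a level `δ > 0` suppose `|β_{k+1}| ≤ B` on all boxes, `β_{k+1} ≤ 0` on the boxes from scale
`k₀` on, and: for every `η > 0` some `ε > 0` has `β_{k+1}(v) ≤ −ε` whenever `k ≥ k₀` and `v ∈ ]0, δ]^{k+1}` has ALL coordinates `≥ η`.  Then there is NO run-wise partial-sum floor at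
level δ: a floor `−M` would confine the deep survivor (which never meets the clamp, by non-positivity) to `1∕g² ≤ 1∕δ² + 2k₀B + max(M,0)`, i.e. to couplings `≥ η > 0`, where it gains
`ε(η)` per scale — contradiction.  The size of the negativity in the SCALE is irrelevant here; what kills is that it is carried by the COUPLINGS (part 13c: `−a·g_k²`; part 12c: `−a·g_k`).
[cite: Balaban1987RG1, (0.20) p.256 and Thm 2 p.259] -/
theorem no_runPS_of_negAwayFromZero {δ B : ℝ} {k₀ : ℕ} (hδ : 0 < δ) (hB : 0 ≤ B)
    (hub : ∀ (k : ℕ) (v : Fin (k + 1) → ℝ), v ∈ Box δ k → β k v ≤ B)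
    (hlb : ∀ (k : ℕ) (v : Fin (k + 1) → ℝ), v ∈ Box δ k → -B ≤ β k v)
    (hnonpos : ∀ (k : ℕ) (v : Fin (k + 1) → ℝ), k₀ ≤ k → v ∈ Box δ k → β k v ≤ 0)
    (haway : ∀ η : ℝ, 0 < η → ∃ ε : ℝ, 0 < ε ∧
      ∀ (k : ℕ) (v : Fin (k + 1) → ℝ), k₀ ≤ k → v ∈ Box δ k → (∀ i, η ≤ v i) → β k v ≤ -ε) (M : ℝ) :
    ∃ (n : ℕ) (gs : ℕ → ℝ), RGEqH n β gs ∧ Step.InInterval δ n gs ∧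
      ∃ k, k ≤ n ∧ ∑ j ∈ Ico k n, β j (prefixOf gs j) < -M := by
  obtain ⟨h1, -, hsurv⟩ := survives_of_eventual_negProfile (e := fun _ => 0) hδ hB (fun _ => le_rfl) hub
    (fun k v hk hv => by simpa using hnonpos k v hk hv)
  set g₀ : ℝ := 1 / Real.sqrt (1 / δ ^ 2 + k₀ * B) with hg₀
  have hpos : 0 < 1 / δ ^ 2 + k₀ * B := by positivity
  have hY0 : Y β δ 0 g₀ = 1 / δ ^ 2 + k₀ * B := by
    rw [Y_zero, hg₀, div_pow, one_pow, Real.sq_sqrt hpos.le, one_div_one_div]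
  have hrg : ∀ n, RGEqH n β (fun i => gClamp δ (Y β δ i g₀)) := fun n => rgEqH_shoot_of_survives hδ fun k _ => hsurv k
  have hI : ∀ n, Step.InInterval δ n (fun i => gClamp δ (Y β δ i g₀)) := fun n => inInterval_shoot hδ n g₀
  by_contra hcon
  push Not at hcon
  -- the survivor loses at most B per scale …
  have hup1 : ∀ k, Y β δ k g₀ ≤ Y β δ 0 g₀ + k * B := by
    intro k
    induction k with
    | zero => simp
    | succ k ih =>
      have hb := hlb k _ (clampPrefix_mem_box (β := β) hδ k g₀)
      rw [Y_succ']
      push_cast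
      linarith
  -- … and, under the would-be floor, climbs at most M after k₀
  have hup2 : ∀ m, Y β δ (k₀ + m) g₀ ≤ Y β δ 0 g₀ + k₀ * B + M := by
    intro m
    have h := hcon (k₀ + m) _ (hrg _) (hI _) k₀ (Nat.le_add_right _ _)
    rw [windowSum_shoot k₀ (k₀ + m) (Nat.le_add_right _ _) g₀] at h
    have := hup1 k₀
    linarith
  set T : ℝ := Y β δ 0 g₀ + k₀ * B + max M 0 with hT
  have hYT : ∀ k, Y β δ k g₀ ≤ T := by
    intro k
    have hM0 : M ≤ max M 0 := le_max_left _ _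
    have h0 : (0 : ℝ) ≤ max M 0 := le_max_right _ _
    rcases le_or_gt k k₀ with hk | hk
    · have h := hup1 k
      have hkB : (k : ℝ) * B ≤ k₀ * B := mul_le_mul_of_nonneg_right (by exact_mod_cast hk) hB
      linarith
    · obtain ⟨m, rfl⟩ : ∃ m, k = k₀ + m := ⟨k - k₀, by omega⟩
      linarith [hup2 m]
  have h1δT : 1 / δ ^ 2 ≤ T := (hsurv 0).trans (hYT 0)
  have hTpos : 0 < T := lt_of_lt_of_le (by positivity) h1δT
  -- so every coupling of the survivor is ≥ η := 1/√T
  have hη : ∀ j, 1 / Real.sqrt T ≤ gClamp δ (Y β δ j g₀) := by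
    intro j
    show 1 / Real.sqrt T ≤ 1 / Real.sqrt (max (Y β δ j g₀) (1 / δ ^ 2))
    exact one_div_le_one_div_of_le (Real.sqrt_pos.mpr (lt_max_of_lt_right (by positivity)))
      (Real.sqrt_le_sqrt (max_le (hYT j) h1δT))
  obtain ⟨ε, hε, hnegε⟩ := haway (1 / Real.sqrt T) (by positivity)
  -- where the β's are ≤ −ε: linear climb after k₀
  have hclimb : ∀ m : ℕ, Y β δ k₀ g₀ + m * ε ≤ Y β δ (k₀ + m) g₀ := by
    intro m
    induction m with
    | zero => simp
    | succ m ih =>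
      have hn := hnegε (k₀ + m) (clampPrefix β δ (k₀ + m) g₀) (Nat.le_add_right _ _)
        (clampPrefix_mem_box (β := β) hδ (k₀ + m) g₀) fun i => hη i
      rw [← add_assoc, Y_succ']
      push_cast
      linarith
  -- contradiction
  obtain ⟨m, hm⟩ := exists_nat_gt ((2 * k₀ * B + M) / ε)
  have hmε : 2 * k₀ * B + M < m * ε := by rwa [div_lt_iff₀ hε] at hm
  have ha := hclimb m
  have hb := hup2 m
  have hc := h1 k₀ le_rfl
  simp only [sub_self, zero_mul, add_zero] at hc
  linarith

end

end Summit.QuantumFields.BalabanUV.Beta.EriceFlowEnclosureB12AsPrintedPointwiseFadingZeroHistoryBoundary
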